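import Mathlib
import Literature.Geometry.Lorentzian.KerrConvergence
import Literature.Geometry.Lorentzian.ImmersionChartMetric
import Literature.Geometry.Lorentzian.BilinPullbackEstimates
import Literature.Geometry.Lorentzian.BoundedGeometry
import Literature.Geometry.Lorentzian.TameChartCompactness
import Summits.FinalStateConjecture.FinalStateConjecture.Theorems.PhotonSphereChannelsTameCensorshipPinNondegenerate

/-!
# Route PhotonSphereChannels · crux `TameCensorship` (stmt-FinalStateConjecture-17431) · line `Sketch`, skeleton v6 ·
# chart bookkeeping for the pancake law: the components of a tame chart and their bounds

Helper file (`--supports stmt-FinalStateConjecture-17431`) of line `Sketch` (lead c2, 2026-08-17). Clause (ii) of K3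
hands the pancake law a late chart `Ψ : U → 𝓢` from the coordinate ball `U = B(0, r₀) ⊆ E4` with `Cᵏ` sup-norm bounds
on the deviation `Ψ^* g − η` (`supCkENorm U 3 ≤ Λ`, `supCkENorm U 0 ≤ ½`). This file turns that datum into the
inputs of the chart calculus: the differentials of `Ψ` are injective (the pin makes `Ψ^* g` non-degenerate, via the
landed `stub_pinNondegenerate`), the transported metric `ImmersionChart.metric` on `U` has the components
`G = deviationExtend + η`, and `G` is pinned (`‖G − η‖ ≤ ½`) with first and second derivatives bounded by `Λ` at
every point of `U`. Pure bookkeeping (operator norms of iterated derivatives versus `supCkENorm`).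

References: DHRT arXiv:2104.08222, §1 (deviation norms); O'Neill 1983, Ch. 3, pp. 90–91 (transported metric).
-/

set_option linter.dupNamespace false
-- instance search through the nested operator type `E4 →L[ℝ] E4 →L[ℝ] ℝ` of metric components
set_option maxSynthPendingDepth 3

open Literature.Geometry.Lorentzian
open scoped Manifold ContDiff Topology
open Set TopologicalSpace

noncomputable section

namespace Summit.FinalStateConjecture.FinalStateConjecture.Theorems.PhotonSphereChannels.TameCensorshipUnwind

variable (𝓢 : Spacetime.{0} 4) (U : Opens E4) (Ψ : (Minkowski.backgroundOn U).domain → 𝓢.carrier)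

/-! Throughout, `Ψ` is typed over `(Minkowski.backgroundOn U).domain` (which is `U` by `rfl`), the typing under which the
deviation API (`Spacetime.deviation`, `deviationExtend`, `IsLateChart`) elaborates without transparency friction; a chart
`Ψ : U → 𝓢.carrier` as in clause (ii) is accepted verbatim. -/

/-- **The pin makes the chart an immersion.** If the deviation `Ψ^* g − η` at `y ∈ U` has operator norm `≤ ½`, the
differential `dΨ_y` is injective: the form `G = Ψ^* g(y)` satisfies `‖v‖ ≤ 2 ‖G(v, ·)‖` (`stub_pinNondegenerate`), and
`G(v, ·) = g(dΨ v, dΨ ·)` vanishes when `dΨ v = 0`. [folklore] -/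
theorem injective_mfderiv_of_deviation_le (y : (Minkowski.backgroundOn U).domain)
    (hpin : ‖𝓢.deviation (Minkowski.backgroundOn U) Ψ y‖ ≤ 1 / 2) :
    Function.Injective (mfderiv 𝓘(ℝ, E4) (𝓡 4) Ψ y) := by
  set Gy : E4 →L[ℝ] E4 →L[ℝ] ℝ := 𝓢.deviation (Minkowski.backgroundOn U) Ψ y + Minkowski.bilin with hGy
  have hGpin : ‖Gy - Minkowski.bilin‖ ≤ 1 / 2 := by
    rw [hGy, add_sub_cancel_right]; exact hpin
  have hGapp : ∀ v w : E4, Gy v w =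
      𝓢.metric.val (Ψ y) (mfderiv 𝓘(ℝ, E4) (𝓡 4) Ψ y v) (mfderiv 𝓘(ℝ, E4) (𝓡 4) Ψ y w) := by
    intro v w
    rw [hGy, add_apply, add_apply, Spacetime.deviation_apply]
    change (_ : ℝ) - Minkowski.bilin v w + Minkowski.bilin v w = _
    rw [sub_add_cancel]
  -- injectivity on the kernel
  refine (injective_iff_map_eq_zero _).2 fun v hv ↦ ?_
  have hzero : Gy v = 0 := by
    ext w
    rw [hGapp, hv]
    simp
  have h := stub_pinNondegenerate Gy hGpin v
  rw [hzero, norm_zero, mul_zero] at h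
  exact norm_le_zero_iff.1 h

variable (hΨ : ContMDiff 𝓘(ℝ, E4) (𝓡 4) (∞ + 1) Ψ)
  (hΨ' : ∀ u, Function.Injective (mfderiv 𝓘(ℝ, E4) (𝓡 4) Ψ u))
  (hdim : Module.finrank ℝ E4 = Module.finrank ℝ (EuclideanSpace ℝ (Fin 4)))

/-- **The components of the transported metric** `Ψ^* g` on `U` are `G = deviationExtend + η`, applied form:
`(Ψ^* g)_y(v, w) = g(dΨ v, dΨ w) = (Ψ^* g − η)_y(v, w) + η(v, w)`. [folklore] -/
theorem immersionChart_metric_val_apply_eq (y : (Minkowski.backgroundOn U).domain) (v w : E4) :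
    (ImmersionChart.metric 𝓢.metric.toPseudoRiemannianMetric hΨ hΨ' hdim).val y v w =
      𝓢.deviationExtend (Minkowski.backgroundOn U) Ψ y v w + Minkowski.bilin v w := by
  have h1 := Spacetime.deviationExtend_coe 𝓢 (Minkowski.backgroundOn U) Ψ y
  have h2 := Spacetime.deviation_apply 𝓢 (Minkowski.backgroundOn U) Ψ y v w
  rw [h1, h2]
  change _ = (_ : ℝ) - Minkowski.bilin v w + Minkowski.bilin v w
  rw [sub_add_cancel]
  rfl

/-- **The components of the transported metric** `Ψ^* g` on `U` are `G = deviationExtend + η` (as bilinear maps; the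
hypothesis shape `∀ y, g.val y = G y` of the chart calculus `OpensChart.*`). [folklore] -/
theorem immersionChart_metric_val_eq_deviationExtend_add (y : (Minkowski.backgroundOn U).domain) :
    (ImmersionChart.metric 𝓢.metric.toPseudoRiemannianMetric hΨ hΨ' hdim).val y =
      𝓢.deviationExtend (Minkowski.backgroundOn U) Ψ y + Minkowski.bilin := by
  ext v w
  exact immersionChart_metric_val_apply_eq 𝓢 U Ψ hΨ hΨ' hdim y v w

omit hΨ hΨ' hdim in
/-- **The pin in the chart**: `supCkENorm U 0 (Ψ^* g − η) ≤ ½` gives `‖G(y) − η‖ ≤ ½` at every `y ∈ U` for the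
components `G = deviationExtend + η`. [folklore] -/
theorem norm_components_sub_bilin_le {y : E4} (hy : y ∈ (U : Set E4))
    (h0 : supCkENorm (U : Set E4) 0 (𝓢.deviationExtend (Minkowski.backgroundOn U) Ψ) ≤ 1 / 2) :
    ‖(𝓢.deviationExtend (Minkowski.backgroundOn U) Ψ y + Minkowski.bilin) - Minkowski.bilin‖ ≤ 1 / 2 := by
  rw [add_sub_cancel_right]
  have h := norm_le_of_supCkENorm_zero_le (by norm_num : (1 / 2 : ENNReal) ≠ ⊤) h0 hy
  have e : (1 / 2 : ENNReal).toReal = 1 / 2 := by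
    rw [ENNReal.toReal_div, ENNReal.toReal_one, ENNReal.toReal_ofNat]
  rwa [e] at h

omit hΨ hΨ' hdim in
/-- **First derivatives of the components**: `supCkENorm U 3 (Ψ^* g − η) ≤ Λ` gives `‖DG(y) v‖ ≤ Λ ‖v‖` on `U`
(`DG = D(Ψ^* g − η)`, the added `η` being constant; `‖D f(y)‖ = ‖iteratedFDeriv 1 f y‖`). [folklore] -/
theorem norm_fderiv_components_le {y : E4} (hy : y ∈ (U : Set E4)) {Λ : NNReal}
    (hΛ : supCkENorm (U : Set E4) 3 (𝓢.deviationExtend (Minkowski.backgroundOn U) Ψ) ≤ (Λ : ENNReal))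
    (v : E4) :
    ‖fderiv ℝ (fun z ↦ 𝓢.deviationExtend (Minkowski.backgroundOn U) Ψ z + Minkowski.bilin) y v‖ ≤ Λ * ‖v‖ := by
  set f := 𝓢.deviationExtend (Minkowski.backgroundOn U) Ψ with hf
  have hD : fderiv ℝ (fun z ↦ f z + Minkowski.bilin) y = fderiv ℝ f y := fderiv_add_const _
  rw [hD]
  have hne : supCkENorm (U : Set E4) 3 f ≠ ⊤ := ne_top_of_le_ne_top ENNReal.coe_ne_top hΛ
  have h1 : ‖iteratedFDeriv ℝ 1 f y‖ ≤ (supCkENorm (U : Set E4) 3 f).toReal :=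
    norm_iteratedFDeriv_le_toReal_supCkENorm (by norm_num) hy f hne
  have h2 : (supCkENorm (U : Set E4) 3 f).toReal ≤ Λ := by
    have := ENNReal.toReal_mono ENNReal.coe_ne_top hΛ
    rwa [ENNReal.coe_toReal] at this
  have h3 : ‖fderiv ℝ f y‖ ≤ Λ := by
    have e : ‖fderiv ℝ f y‖ = ‖iteratedFDeriv ℝ 1 f y‖ := by
      rw [← norm_iteratedFDeriv_fderiv (n := 0), norm_iteratedFDeriv_zero]
    rw [e]; exact h1.trans h2
  exact (ContinuousLinearMap.le_opNorm _ v).trans (mul_le_mul_of_nonneg_right h3 (norm_nonneg v))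

omit hΨ hΨ' hdim in
/-- **Second derivatives of the components**: `supCkENorm U 3 (Ψ^* g − η) ≤ Λ` gives
`‖D²G(y)(v, w)‖ ≤ Λ ‖v‖ ‖w‖` on `U` (`‖D(Df)(y)‖ = ‖iteratedFDeriv 2 f y‖`). [folklore] -/
theorem norm_fderiv_fderiv_components_le {y : E4} (hy : y ∈ (U : Set E4)) {Λ : NNReal}
    (hΛ : supCkENorm (U : Set E4) 3 (𝓢.deviationExtend (Minkowski.backgroundOn U) Ψ) ≤ (Λ : ENNReal))
    (v w : E4) :
    ‖fderiv ℝ (fderiv ℝ (fun z ↦ 𝓢.deviationExtend (Minkowski.backgroundOn U) Ψ z + Minkowski.bilin)) y v w‖ ≤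
      Λ * ‖v‖ * ‖w‖ := by
  set f := 𝓢.deviationExtend (Minkowski.backgroundOn U) Ψ with hf
  have hD : fderiv ℝ (fun z ↦ f z + Minkowski.bilin) = fderiv ℝ f := by
    funext z; exact fderiv_add_const _
  rw [hD]
  have hne : supCkENorm (U : Set E4) 3 f ≠ ⊤ := ne_top_of_le_ne_top ENNReal.coe_ne_top hΛ
  have h1 : ‖iteratedFDeriv ℝ 2 f y‖ ≤ (supCkENorm (U : Set E4) 3 f).toReal :=
    norm_iteratedFDeriv_le_toReal_supCkENorm (by norm_num) hy f hne
  have h2 : (supCkENorm (U : Set E4) 3 f).toReal ≤ Λ := by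
    have := ENNReal.toReal_mono ENNReal.coe_ne_top hΛ
    rwa [ENNReal.coe_toReal] at this
  have h3 : ‖fderiv ℝ (fderiv ℝ f) y‖ ≤ Λ := by
    have e : ‖fderiv ℝ (fderiv ℝ f) y‖ = ‖iteratedFDeriv ℝ 2 f y‖ := by
      rw [← norm_iteratedFDeriv_fderiv (n := 1), ← norm_iteratedFDeriv_fderiv (n := 0),
        norm_iteratedFDeriv_zero]
    rw [e]; exact h1.trans h2
  calc ‖fderiv ℝ (fderiv ℝ f) y v w‖ ≤ ‖fderiv ℝ (fderiv ℝ f) y v‖ * ‖w‖ := ContinuousLinearMap.le_opNorm _ w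
    _ ≤ ‖fderiv ℝ (fderiv ℝ f) y‖ * ‖v‖ * ‖w‖ := by
        gcongr; exact ContinuousLinearMap.le_opNorm _ v
    _ ≤ Λ * ‖v‖ * ‖w‖ := by gcongr

/-- **Registered form** (`stub_chartComponents`, explicit binders): the components of the transported metric of a
chart typed over the Minkowski background domain are `deviationExtend + η`. [folklore] -/
theorem stub_chartComponents :
    ∀ (𝓢 : Spacetime.{0} 4) (U : TopologicalSpace.Opens E4) (Ψ : (Minkowski.backgroundOn U).domain → 𝓢.carrier) (hΨ : ContMDiff 𝓘(ℝ, E4) (𝓡 4) (∞ + 1) Ψ) (hΨ' : ∀ u, Function.Injective (mfderiv 𝓘(ℝ, E4) (𝓡 4) Ψ u)) (hdim : Module.finrank ℝ E4 = Module.finrank ℝ (EuclideanSpace ℝ (Fin 4))) (y : (Minkowski.backgroundOn U).domain), (ImmersionChart.metric 𝓢.metric.toPseudoRiemannianMetric hΨ hΨ' hdim).val y = 𝓢.deviationExtend (Minkowski.backgroundOn U) Ψ y + Minkowski.bilin :=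
  fun 𝓢 U Ψ hΨ hΨ' hdim y ↦ immersionChart_metric_val_eq_deviationExtend_add 𝓢 U Ψ hΨ hΨ' hdim y

end Summit.FinalStateConjecture.FinalStateConjecture.Theorems.PhotonSphereChannels.TameCensorshipUnwind

end
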